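import Summits.CriticalPhenomena.PercolationContinuityZ3.Theorems.PercNearOneGluingNoHeavyLowerTailFloorSplitOneLayerRows
import HarnessLib

/-!
# `NoHeavyLowerTail` (stmt-CriticalPhenomena-4575) — the floor-split CIL for ONE-LAYER observers (PROVED)

Lemma factory #5 (`prim-lf-5`, gen 10; memo `run/shared/lean/prim/prim-lf-5/FSCIL-ONELAYER-PROOF.md`).
`--supports stmt-CriticalPhenomena-4575`.  No definitions, no named facts, no sorries.

**Theorem (`floorSplitCIL_oneLayer`).**  On a finite weighted graph let `o ∉ A` be a ONE-LAYER observer of the relay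
set `A` (every pair `s(o,u)` with `u ∉ A`, `u ≠ o` has weight `0`), `N = |{x ∈ A : o ↔ x}|`, `N_a = |{x ∈ A : a ↔ x}|`,
`φ_a = μ(o ↔ a, N_a = 1)/μ(N_a = 1)` (Kozma–Nitzan's singleton ratios), and let `c ∈ A` dominate every `μ(N_a ≤ j)`.
Then

  `μ(1 ≤ N ≤ j) ≤ Σ_{a∈A} φ_a μ(N_a ≤ j) + (μ(o ↔ A) − Σ_{a∈A} φ_a)·μ(N_c ≤ j)`,

i.e. the hypothesis `hFS` of `noHeavyLowerTail_of_floorSplitCIL` (FSCIL, which closes the crux) HOLDS for one-layer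
observers.  This is Kozma–Nitzan's Theorem 8 (for the cluster-size property) sharpened to floor-split form: the
singleton floors pay their own relay's lightness and only the excess `σ' = μ(o↔A) − Σφ` pays the champion's.

Proof (memo, one page): decompose along the stars `σ_B` of `o` (`…FloorSplitOneLayerStars/Sums`); with `c₀` the
`H`-lightest relay (`H = G ∖ {o}`) the abstract star algebra `FloorSplitOneLayer.starAlgebra` reduces the claim for
the witness `c₀` to the star rows `r_B + q_v − n_v(B) ≤ q_{c₀}`, which are `FloorSplitOneLayer.starRow_small`
(Kozma–Nitzan Lemma 3(ii)/3(i), cluster forms = BHK) read on `H` (`starRow_transfer`), and to the floor-weight bound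
`phi_le`; finally `σ' ≥ 0` (`sigma_nonneg`) moves the witness from `c₀` to the `G`-champion `c`.
-/

noncomputable section

namespace Summit.CriticalPhenomena.PercolationContinuityZ3.Theorems

open MeasureTheory Set Literature.Probability.LatticeModels Literature.Probability.Percolation
open Literature.Probability.Percolation.KNPreFKG
open scoped Classical

variable {V : Type*} [Fintype V]

/-- **The floor-split cumulative isolation lemma for one-layer observers.**  If `o ∉ A` is joined with positive
weight only to relays (`w s(o,u) = 0` for `u ∉ A`, `u ≠ o`) and `c ∈ A` satisfies `μ(N_a ≤ j) ≤ μ(N_c ≤ j)` for all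
`a ∈ A`, then `μ(1 ≤ N ≤ j) ≤ Σ_a φ_a μ(N_a ≤ j) + (μ(o↔A) − Σ_a φ_a) μ(N_c ≤ j)` with
`φ_a = μ(o ↔ a, N_a = 1)/μ(N_a = 1)`.  [this work; cite: KozmaNitzan2024, Thm. 8 (p. 32), Lemma 3 (pp. 6–7), Lemma 5 (p. 13)] -/
theorem floorSplitCIL_oneLayer (w : Sym2 V → unitInterval) (A : Finset V) (o : V) (j : ℕ) (ho : o ∉ A)
    (hiso : ∀ u, u ≠ o → u ∉ A → w s(o, u) = 0) (c : V) (hc : c ∈ A)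
    (hcmax : ∀ a ∈ A,
      (prodBernoulli w).real {ω : BondConfig V | (A.filter fun x => ω ∈ openConn a x).card ≤ j} ≤
        (prodBernoulli w).real {ω : BondConfig V | (A.filter fun x => ω ∈ openConn c x).card ≤ j}) :
    (prodBernoulli w).real {ω : BondConfig V |
        1 ≤ (A.filter fun x => ω ∈ openConn o x).card ∧ (A.filter fun x => ω ∈ openConn o x).card ≤ j} ≤
      (∑ a ∈ A,
          (prodBernoulli w).real ((openConn o a : Set (BondConfig V)) ∩
              {ω | (A.filter fun x => ω ∈ openConn a x).card = 1}) /
            (prodBernoulli w).real {ω : BondConfig V | (A.filter fun x => ω ∈ openConn a x).card = 1} *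
          (prodBernoulli w).real {ω : BondConfig V | (A.filter fun x => ω ∈ openConn a x).card ≤ j}) +
        ((prodBernoulli w).real (⋃ a ∈ A, (openConn o a : Set (BondConfig V))) -
            ∑ a ∈ A,
              (prodBernoulli w).real ((openConn o a : Set (BondConfig V)) ∩
                  {ω | (A.filter fun x => ω ∈ openConn a x).card = 1}) /
                (prodBernoulli w).real {ω : BondConfig V | (A.filter fun x => ω ∈ openConn a x).card = 1}) *
          (prodBernoulli w).real {ω : BondConfig V | (A.filter fun x => ω ∈ openConn c x).card ≤ j} := by
  set μ := prodBernoulli w with hμ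
  -- the abstract star data
  set wB : Finset V → ℝ := fun B => μ.real (starEvent o (↑B : Set V)) with hwB
  set q : V → ℝ := fun v => μ.real {ω : BondConfig V | (A.filter fun x => ω ∈ openConnIn {o}ᶜ v x).card ≤ j}
    with hq
  set r : Finset V → ℝ := fun B =>
    μ.real {ω : BondConfig V | (A.filter fun x => ∃ u ∈ B, ω ∈ openConnIn {o}ᶜ u x).card ≤ j} with hr
  set n : V → Finset V → ℝ := fun v B =>
    μ.real ({ω : BondConfig V | (A.filter fun x => ω ∈ openConnIn {o}ᶜ v x).card ≤ j} ∩
        {ω | ∀ u ∈ B, ω ∉ openConnIn {o}ᶜ v u}) +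
      μ.real ({ω : BondConfig V | (A.filter fun x => ∃ u ∈ B, ω ∈ openConnIn {o}ᶜ u x).card ≤ j} ∩
        {ω | ∃ u ∈ B, ω ∈ openConnIn {o}ᶜ v u}) with hn
  set φ : V → ℝ := fun a =>
    μ.real ((openConn o a : Set (BondConfig V)) ∩ {ω | (A.filter fun x => ω ∈ openConn a x).card = 1}) /
      μ.real {ω : BondConfig V | (A.filter fun x => ω ∈ openConn a x).card = 1} with hφ
  set I : V → ℝ := fun v => μ.real {ω : BondConfig V | (A.filter fun x => ω ∈ openConn v x).card ≤ j} with hI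
  -- the `H`-lightest relay `c₀`
  obtain ⟨c₀, hc₀A, hc₀max⟩ := Finset.exists_max_image A q ⟨c, hc⟩
  have hc₀o : c₀ ≠ o := fun h => ho (h ▸ hc₀A)
  -- hypotheses of the star algebra
  have hw0 : ∀ B ∈ A.powerset, 0 ≤ wB B := fun B _ => measureReal_nonneg
  have hw1 : ∑ B ∈ A.powerset, wB B = 1 := FloorSplitOneLayer.sum_real_starEvent_eq_one w A o ho hiso
  have hr1 : ∀ a ∈ A, r {a} = q a := by
    intro a _
    simp only [hr, hq, FloorSplitOneLayer.usmall_singleton_eq]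
  have hn1 : ∀ v ∈ A, ∀ B ∈ A.powerset, B.card ≤ 1 → v ∉ B → n v B = q v := by
    intro v _ B _ hcard _
    rcases Nat.le_one_iff_eq_zero_or_eq_one.1 hcard with h0 | h1
    · rw [Finset.card_eq_zero] at h0
      subst h0
      exact FloorSplitOneLayer.n_empty_eq w A o j v
    · obtain ⟨b, rfl⟩ := Finset.card_eq_one.1 h1
      exact FloorSplitOneLayer.n_singleton_eq w A o j v b
  have hrow0 : ∀ B ∈ A.powerset, B.Nonempty → r B ≤ q c₀ := by
    intro B hB ⟨b, hb⟩
    exact (FloorSplitOneLayer.real_usmall_le_small w A o j hb).trans (hc₀max b (Finset.mem_powerset.1 hB hb))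
  have hrow : ∀ B ∈ A.powerset, 2 ≤ B.card → ∀ v ∈ A, v ∉ B → r B + q v - n v B ≤ q c₀ := by
    intro B hB _ v hvA _
    have hBA : B ⊆ A := Finset.mem_powerset.1 hB
    have hB' : ∀ u ∈ B, u ≠ o := fun u hu h => ho (h ▸ hBA hu)
    have hvo : v ≠ o := fun h => ho (h ▸ hvA)
    have hBne : B.Nonempty := Finset.card_pos.1 (by omega)
    obtain ⟨b, hb⟩ := hBne
    have e := FloorSplitOneLayer.row_quantity_eq w A o j v B
    have t := FloorSplitOneLayer.starRow_transfer w A j hB' hc₀o hvo (hc₀max v hvA) ⟨b, hb, hc₀max b (hBA hb)⟩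
    simp only [hr, hq, hn]
    rw [e]
    exact t
  have hφ0 : ∀ a ∈ A, 0 ≤ φ a := fun a _ => div_nonneg measureReal_nonneg measureReal_nonneg
  have hφ1 : ∀ a ∈ A, φ a ≤ wB {a} / (wB {a} + ∑ B ∈ A.powerset.filter (fun B => a ∉ B), wB B) :=
    fun a ha => FloorSplitOneLayer.phi_le w A ho hiso ha
  -- the star algebra for the witness `c₀`
  have key := FloorSplitOneLayer.starAlgebra A c₀ hc₀A wB q r n φ hw0 hw1 hr1 hn1
    (fun a ha => hc₀max a ha) hrow0 hrow hφ0 hφ1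
  -- read the abstract sums as probabilities
  have hbad : μ.real {ω : BondConfig V | 1 ≤ (A.filter fun x => ω ∈ openConn o x).card ∧
      (A.filter fun x => ω ∈ openConn o x).card ≤ j} =
      ∑ B ∈ A.powerset.filter (fun B => B.Nonempty), wB B * r B :=
    FloorSplitOneLayer.real_bad_eq_sum w A ho hiso j
  have hIv : ∀ v ∈ A, ∑ B ∈ A.powerset, wB B * (if v ∈ B then r B else n v B) = I v := by
    intro v hvA
    simp only [hI]
    rw [FloorSplitOneLayer.real_light_eq_sum w A ho hiso j hvA]
  have hPoA : ∑ B ∈ A.powerset.filter (fun B => B.Nonempty), wB B =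
      μ.real (⋃ a ∈ A, (openConn o a : Set (BondConfig V))) :=
    (FloorSplitOneLayer.real_obsConn_eq_sum w A o ho hiso).symm
  have hσ : ∑ a ∈ A, φ a ≤ ∑ B ∈ A.powerset.filter (fun B => B.Nonempty), wB B :=
    FloorSplitOneLayer.sigma_nonneg A wB φ hw0 hw1 hφ0 hφ1
  have hsumI : ∑ a ∈ A, φ a * ∑ B ∈ A.powerset, wB B * (if a ∈ B then r B else n a B) = ∑ a ∈ A, φ a * I a :=
    Finset.sum_congr rfl fun a ha => by rw [hIv a ha]
  rw [hbad]
  refine key.trans ?_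
  rw [hsumI, hIv c₀ hc₀A, hPoA]
  have hcc : I c₀ ≤ I c := hcmax c₀ hc₀A
  have hσ' : 0 ≤ μ.real (⋃ a ∈ A, (openConn o a : Set (BondConfig V))) - ∑ a ∈ A, φ a := by
    rw [← hPoA]; linarith
  have := mul_le_mul_of_nonneg_left hcc hσ'
  simp only [hI] at this ⊢
  linarith

/-- **One-layer FSCIL in the binder shape of `noHeavyLowerTail_of_floorSplitCIL`'s hypothesis `hFS`, restricted to
one-layer observers**: for every `n`, weights `w` on `Fin n`, nonempty relay set `A`, one-layer observer `o ∉ A`, level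
`j` and `G`-champion `c`, the floor-split inequality holds. [this work] -/
theorem floorSplitCIL_oneLayer_fin :
    ∀ (n : ℕ) (w : Sym2 (Fin n) → unitInterval) (A : Finset (Fin n)) (o : Fin n) (j : ℕ),
      A.Nonempty → o ∉ A → (∀ u, u ≠ o → u ∉ A → w s(o, u) = 0) → ∀ c ∈ A,
        (∀ a ∈ A,
          (prodBernoulli w).real {ω : BondConfig (Fin n) |
              (A.filter fun x => ω ∈ openConn a x).card ≤ j} ≤
            (prodBernoulli w).real {ω : BondConfig (Fin n) |
              (A.filter fun x => ω ∈ openConn c x).card ≤ j}) →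
        (prodBernoulli w).real {ω : BondConfig (Fin n) |
            1 ≤ (A.filter fun x => ω ∈ openConn o x).card ∧
              (A.filter fun x => ω ∈ openConn o x).card ≤ j} ≤
          (∑ a ∈ A,
              (prodBernoulli w).real
                  ((openConn o a : Set (BondConfig (Fin n))) ∩
                    {ω | (A.filter fun x => ω ∈ openConn a x).card = 1}) /
                (prodBernoulli w).real {ω : BondConfig (Fin n) |
                  (A.filter fun x => ω ∈ openConn a x).card = 1} *
              (prodBernoulli w).real {ω : BondConfig (Fin n) |
                (A.filter fun x => ω ∈ openConn a x).card ≤ j}) +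
            ((prodBernoulli w).real (⋃ a ∈ A, (openConn o a : Set (BondConfig (Fin n)))) -
                ∑ a ∈ A,
                  (prodBernoulli w).real
                      ((openConn o a : Set (BondConfig (Fin n))) ∩
                        {ω | (A.filter fun x => ω ∈ openConn a x).card = 1}) /
                    (prodBernoulli w).real {ω : BondConfig (Fin n) |
                      (A.filter fun x => ω ∈ openConn a x).card = 1}) *
              (prodBernoulli w).real {ω : BondConfig (Fin n) |
                (A.filter fun x => ω ∈ openConn c x).card ≤ j} :=
  fun _ w A o j _ ho hiso c hc hcmax => floorSplitCIL_oneLayer w A o j ho hiso c hc hcmax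

/-- **One-layer FSCIL with the `H`-champion as witness** (the sharper form actually proved): if `o ∉ A` is a one-layer
observer and `c₀ ∈ A` is lightest OFF the observer — `μ(|{x ∈ A : a ↔ x off o}| ≤ j) ≤ μ(|{x ∈ A : c₀ ↔ x off o}| ≤ j)` for all
`a ∈ A` (lightness in `H = G ∖ {o}`) — then `μ(1 ≤ N ≤ j) ≤ Σ_a φ_a μ(N_a ≤ j) + (μ(o↔A) − Σ_a φ_a) μ(N_{c₀} ≤ j)`.  No `σ' ≥ 0`
step is needed here; `floorSplitCIL_oneLayer` is this plus `sigma_nonneg`. [this work] -/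
theorem floorSplitCIL_oneLayer_Hwitness (w : Sym2 V → unitInterval) (A : Finset V) (o : V) (j : ℕ) (ho : o ∉ A)
    (hiso : ∀ u, u ≠ o → u ∉ A → w s(o, u) = 0) (c₀ : V) (hc₀A : c₀ ∈ A)
    (hc₀max : ∀ a ∈ A,
      (prodBernoulli w).real {ω : BondConfig V | (A.filter fun x => ω ∈ openConnIn {o}ᶜ a x).card ≤ j} ≤
        (prodBernoulli w).real {ω : BondConfig V | (A.filter fun x => ω ∈ openConnIn {o}ᶜ c₀ x).card ≤ j}) :
    (prodBernoulli w).real {ω : BondConfig V |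
        1 ≤ (A.filter fun x => ω ∈ openConn o x).card ∧ (A.filter fun x => ω ∈ openConn o x).card ≤ j} ≤
      (∑ a ∈ A,
          (prodBernoulli w).real ((openConn o a : Set (BondConfig V)) ∩
              {ω | (A.filter fun x => ω ∈ openConn a x).card = 1}) /
            (prodBernoulli w).real {ω : BondConfig V | (A.filter fun x => ω ∈ openConn a x).card = 1} *
          (prodBernoulli w).real {ω : BondConfig V | (A.filter fun x => ω ∈ openConn a x).card ≤ j}) +
        ((prodBernoulli w).real (⋃ a ∈ A, (openConn o a : Set (BondConfig V))) -
            ∑ a ∈ A,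
              (prodBernoulli w).real ((openConn o a : Set (BondConfig V)) ∩
                  {ω | (A.filter fun x => ω ∈ openConn a x).card = 1}) /
                (prodBernoulli w).real {ω : BondConfig V | (A.filter fun x => ω ∈ openConn a x).card = 1}) *
          (prodBernoulli w).real {ω : BondConfig V | (A.filter fun x => ω ∈ openConn c₀ x).card ≤ j} := by
  set μ := prodBernoulli w with hμ
  -- the abstract star data
  set wB : Finset V → ℝ := fun B => μ.real (starEvent o (↑B : Set V)) with hwB
  set q : V → ℝ := fun v => μ.real {ω : BondConfig V | (A.filter fun x => ω ∈ openConnIn {o}ᶜ v x).card ≤ j}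
    with hq
  set r : Finset V → ℝ := fun B =>
    μ.real {ω : BondConfig V | (A.filter fun x => ∃ u ∈ B, ω ∈ openConnIn {o}ᶜ u x).card ≤ j} with hr
  set n : V → Finset V → ℝ := fun v B =>
    μ.real ({ω : BondConfig V | (A.filter fun x => ω ∈ openConnIn {o}ᶜ v x).card ≤ j} ∩
        {ω | ∀ u ∈ B, ω ∉ openConnIn {o}ᶜ v u}) +
      μ.real ({ω : BondConfig V | (A.filter fun x => ∃ u ∈ B, ω ∈ openConnIn {o}ᶜ u x).card ≤ j} ∩
        {ω | ∃ u ∈ B, ω ∈ openConnIn {o}ᶜ v u}) with hn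
  set φ : V → ℝ := fun a =>
    μ.real ((openConn o a : Set (BondConfig V)) ∩ {ω | (A.filter fun x => ω ∈ openConn a x).card = 1}) /
      μ.real {ω : BondConfig V | (A.filter fun x => ω ∈ openConn a x).card = 1} with hφ
  set I : V → ℝ := fun v => μ.real {ω : BondConfig V | (A.filter fun x => ω ∈ openConn v x).card ≤ j} with hI
  -- the `H`-lightest relay `c₀`
  have hc₀max' : ∀ a ∈ A, q a ≤ q c₀ := fun a ha => hc₀max a ha
  have hc₀o : c₀ ≠ o := fun h => ho (h ▸ hc₀A)
  -- hypotheses of the star algebra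
  have hw0 : ∀ B ∈ A.powerset, 0 ≤ wB B := fun B _ => measureReal_nonneg
  have hw1 : ∑ B ∈ A.powerset, wB B = 1 := FloorSplitOneLayer.sum_real_starEvent_eq_one w A o ho hiso
  have hr1 : ∀ a ∈ A, r {a} = q a := by
    intro a _
    simp only [hr, hq, FloorSplitOneLayer.usmall_singleton_eq]
  have hn1 : ∀ v ∈ A, ∀ B ∈ A.powerset, B.card ≤ 1 → v ∉ B → n v B = q v := by
    intro v _ B _ hcard _
    rcases Nat.le_one_iff_eq_zero_or_eq_one.1 hcard with h0 | h1
    · rw [Finset.card_eq_zero] at h0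
      subst h0
      exact FloorSplitOneLayer.n_empty_eq w A o j v
    · obtain ⟨b, rfl⟩ := Finset.card_eq_one.1 h1
      exact FloorSplitOneLayer.n_singleton_eq w A o j v b
  have hrow0 : ∀ B ∈ A.powerset, B.Nonempty → r B ≤ q c₀ := by
    intro B hB ⟨b, hb⟩
    exact (FloorSplitOneLayer.real_usmall_le_small w A o j hb).trans (hc₀max' b (Finset.mem_powerset.1 hB hb))
  have hrow : ∀ B ∈ A.powerset, 2 ≤ B.card → ∀ v ∈ A, v ∉ B → r B + q v - n v B ≤ q c₀ := by
    intro B hB _ v hvA _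
    have hBA : B ⊆ A := Finset.mem_powerset.1 hB
    have hB' : ∀ u ∈ B, u ≠ o := fun u hu h => ho (h ▸ hBA hu)
    have hvo : v ≠ o := fun h => ho (h ▸ hvA)
    have hBne : B.Nonempty := Finset.card_pos.1 (by omega)
    obtain ⟨b, hb⟩ := hBne
    have e := FloorSplitOneLayer.row_quantity_eq w A o j v B
    have t := FloorSplitOneLayer.starRow_transfer w A j hB' hc₀o hvo (hc₀max' v hvA) ⟨b, hb, hc₀max' b (hBA hb)⟩
    simp only [hr, hq, hn]
    rw [e]
    exact t
  have hφ0 : ∀ a ∈ A, 0 ≤ φ a := fun a _ => div_nonneg measureReal_nonneg measureReal_nonneg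
  have hφ1 : ∀ a ∈ A, φ a ≤ wB {a} / (wB {a} + ∑ B ∈ A.powerset.filter (fun B => a ∉ B), wB B) :=
    fun a ha => FloorSplitOneLayer.phi_le w A ho hiso ha
  -- the star algebra for the witness `c₀`
  have key := FloorSplitOneLayer.starAlgebra A c₀ hc₀A wB q r n φ hw0 hw1 hr1 hn1
    hc₀max' hrow0 hrow hφ0 hφ1
  -- read the abstract sums as probabilities
  have hbad : μ.real {ω : BondConfig V | 1 ≤ (A.filter fun x => ω ∈ openConn o x).card ∧
      (A.filter fun x => ω ∈ openConn o x).card ≤ j} =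
      ∑ B ∈ A.powerset.filter (fun B => B.Nonempty), wB B * r B :=
    FloorSplitOneLayer.real_bad_eq_sum w A ho hiso j
  have hIv : ∀ v ∈ A, ∑ B ∈ A.powerset, wB B * (if v ∈ B then r B else n v B) = I v := by
    intro v hvA
    simp only [hI]
    rw [FloorSplitOneLayer.real_light_eq_sum w A ho hiso j hvA]
  have hPoA : ∑ B ∈ A.powerset.filter (fun B => B.Nonempty), wB B =
      μ.real (⋃ a ∈ A, (openConn o a : Set (BondConfig V))) :=
    (FloorSplitOneLayer.real_obsConn_eq_sum w A o ho hiso).symm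
  have hsumI : ∑ a ∈ A, φ a * ∑ B ∈ A.powerset, wB B * (if a ∈ B then r B else n a B) = ∑ a ∈ A, φ a * I a :=
    Finset.sum_congr rfl fun a ha => by rw [hIv a ha]
  rw [hbad]
  refine key.trans ?_
  rw [hsumI, hIv c₀ hc₀A, hPoA]


end Summit.CriticalPhenomena.PercolationContinuityZ3.Theorems

end
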